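import Literature.NumberTheory.LFunctions.WeilExplicit
import Literature.NumberTheory.LFunctions.WeilZeroSum
import Mathlib.Analysis.SpecialFunctions.Gaussian.GaussianIntegral
import Mathlib.Analysis.SpecialFunctions.ExpDeriv
import Mathlib.Analysis.Calculus.Deriv.Pow
import Mathlib.Analysis.Complex.RealDeriv
import HarnessLib

/-!
# `WeilGroundState.GroundStatesConvergeToXi` — Gaussians lie in the exponential Weil class
(crux item stmt-RiemannHypothesis-1527, route route-RiemannHypothesis-WeilGroundState; line `Sketch`,
stub `stub_gaussian_expClass` (E1); `--supports`)

The lead's explicit formula for the EXPONENTIAL WEIL CLASS (smooth `f` with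
`‖f‖, ‖f′‖, ‖f″‖ ≤ C e^{-b₀|t|}`, `b₀ > 1/2`: `Σ'_ρ m(ρ) f̂(ρ) = W(f)`, absolutely convergent) enters
here only as a HYPOTHESIS (EF). This file records that every Gaussian `g_c(t) = e^{-c t²}`,
`c > 0`, is a member of the class with rate `1`:

* `g_c` is smooth (`gaussEC_contDiff`);
* `g_c' = -2ct·g_c`, `g_c'' = (4c²t² - 2c)·g_c` (`gaussEC_deriv`, `gaussEC_deriv2`);
* `e^{-cu²}, u e^{-cu²}, u² e^{-cu²} ≤ e^{9/(4c)} e^{-u}` for `u ≥ 0` (`gaussEC_three`: `u ≤ e^u`,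
  `u² ≤ e^{2u}` and `3u - cu² ≤ 9/(4c)` by completing the square), whence the three bounds with
  the constant `C = (1 + 2c)² e^{9/(4c)}` (`gaussEC_bounds`);
* so (EF) applies with `b₀ = 1`, and `hasWeilZeroSide_tsum` (`WeilZeroSum.lean`) turns the
  absolutely convergent identity into the symmetric-limit statement `HasWeilZeroSide g_c (W g_c)`.

No new definitions; no named fact is used.
-/

noncomputable section

set_option linter.dupNamespace false

open scoped Topology Real
open Filter Set MeasureTheory Complex

namespace Summit.RiemannHypothesis.RiemannHypothesis.Theorems.GroundStatesConvergeToXi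

open Literature.NumberTheory.LFunctions

/-! ## Smoothness and the first two derivatives of `t ↦ e^{-ct²}` -/

/-- The Gaussian `t ↦ e^{-ct²}`, viewed as a complex-valued function of a real variable, is
smooth. [folklore] -/
theorem gaussEC_contDiff (c : ℝ) :
    ContDiff ℝ (⊤ : ℕ∞) (fun t : ℝ => (Real.exp (-(c * t ^ 2)) : ℂ)) := by
  have h1 : ContDiff ℝ (⊤ : ℕ∞) (fun t : ℝ => Real.exp (-(c * t ^ 2))) :=
    (contDiff_const.mul (contDiff_id.pow 2)).neg.exp
  have h2 : (fun t : ℝ => (Real.exp (-(c * t ^ 2)) : ℂ)) =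
      Complex.ofRealCLM ∘ fun t : ℝ => Real.exp (-(c * t ^ 2)) := by
    ext1 t
    simp
  rw [h2]
  exact Complex.ofRealCLM.contDiff.comp h1

/-- `d/dt e^{-ct²} = -2ct e^{-ct²}` (real form). [folklore] -/
theorem gaussEC_hasDerivAt_real (c t : ℝ) :
    HasDerivAt (fun t : ℝ => Real.exp (-(c * t ^ 2)))
      (-2 * c * t * Real.exp (-(c * t ^ 2))) t := by
  have h1 : HasDerivAt (fun t : ℝ => t ^ 2) (2 * t) t := by
    simpa using hasDerivAt_pow 2 t
  exact ((h1.const_mul c).fun_neg).exp.congr_deriv (by ring)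

/-- `d/dt e^{-ct²} = -2ct e^{-ct²}` (complex-valued form). [folklore] -/
theorem gaussEC_hasDerivAt (c t : ℝ) :
    HasDerivAt (fun t : ℝ => (Real.exp (-(c * t ^ 2)) : ℂ))
      (((-2 * c * t * Real.exp (-(c * t ^ 2)) : ℝ) : ℂ)) t :=
  (gaussEC_hasDerivAt_real c t).ofReal_comp

/-- The derivative of the complex-valued Gaussian: `(e^{-ct²})' = -2ct e^{-ct²}`. [folklore] -/
theorem gaussEC_deriv (c : ℝ) :
    deriv (fun t : ℝ => (Real.exp (-(c * t ^ 2)) : ℂ)) =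
      fun t : ℝ => (((-2 * c * t * Real.exp (-(c * t ^ 2)) : ℝ) : ℂ)) :=
  funext fun t => (gaussEC_hasDerivAt c t).deriv

/-- `d/dt (-2ct e^{-ct²}) = (4c²t² - 2c) e^{-ct²}` (real form). [folklore] -/
theorem gaussEC_hasDerivAt2_real (c t : ℝ) :
    HasDerivAt (fun t : ℝ => -2 * c * t * Real.exp (-(c * t ^ 2)))
      ((4 * c ^ 2 * t ^ 2 - 2 * c) * Real.exp (-(c * t ^ 2))) t := by
  have h1 : HasDerivAt (fun t : ℝ => -2 * c * t) (-2 * c) t := hasDerivAt_const_mul (-2 * c)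
  exact (h1.fun_mul (gaussEC_hasDerivAt_real c t)).congr_deriv (by ring)

/-- The second derivative of the complex-valued Gaussian:
`(e^{-ct²})'' = (4c²t² - 2c) e^{-ct²}`. [folklore] -/
theorem gaussEC_deriv2 (c : ℝ) :
    deriv (deriv (fun t : ℝ => (Real.exp (-(c * t ^ 2)) : ℂ))) =
      fun t : ℝ => ((((4 * c ^ 2 * t ^ 2 - 2 * c) * Real.exp (-(c * t ^ 2)) : ℝ)) : ℂ) := by
  rw [gaussEC_deriv c]
  exact funext fun t => (gaussEC_hasDerivAt2_real c t).ofReal_comp.deriv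

/-! ## The exponential bounds with rate `1` -/

/-- For `c > 0` and `u ≥ 0`: `e^{-cu²}`, `u e^{-cu²}` and `u² e^{-cu²}` are all at most
`e^{9/(4c)} e^{-u}` (`u ≤ e^u`, `u² ≤ e^{2u}`, and `3u - cu² ≤ 9/(4c)` by completing the
square). [folklore] -/
theorem gaussEC_three {c : ℝ} (hc : 0 < c) {u : ℝ} (hu : 0 ≤ u) :
    Real.exp (-(c * u ^ 2)) ≤ Real.exp (9 / (4 * c)) * Real.exp (-u) ∧
    u * Real.exp (-(c * u ^ 2)) ≤ Real.exp (9 / (4 * c)) * Real.exp (-u) ∧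
    u ^ 2 * Real.exp (-(c * u ^ 2)) ≤ Real.exp (9 / (4 * c)) * Real.exp (-u) := by
  have key : ∀ a : ℝ, a ≤ 2 →
      Real.exp (a * u) * Real.exp (-(c * u ^ 2)) ≤ Real.exp (9 / (4 * c)) * Real.exp (-u) := by
    intro a ha
    rw [← Real.exp_add, ← Real.exp_add, Real.exp_le_exp]
    have h1 : a * u ≤ 2 * u := mul_le_mul_of_nonneg_right ha hu
    have h2 : 3 * u - c * u ^ 2 ≤ 9 / (4 * c) := by
      rw [le_div_iff₀ (by positivity)]
      nlinarith [sq_nonneg (3 - 2 * c * u)]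
    linarith
  have hu1 : u ≤ Real.exp u := by linarith [Real.add_one_le_exp u]
  have hu2 : u ^ 2 ≤ Real.exp (2 * u) := by
    calc u ^ 2 ≤ Real.exp u ^ 2 := pow_le_pow_left₀ hu hu1 2
      _ = Real.exp (2 * u) := by rw [sq, ← Real.exp_add, two_mul]
  have hE : 0 ≤ Real.exp (-(c * u ^ 2)) := (Real.exp_pos _).le
  refine ⟨?_, ?_, ?_⟩
  · have h := key 0 (by norm_num)
    rwa [zero_mul, Real.exp_zero, one_mul] at h
  · calc u * Real.exp (-(c * u ^ 2)) ≤ Real.exp u * Real.exp (-(c * u ^ 2)) :=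
          mul_le_mul_of_nonneg_right hu1 hE
      _ = Real.exp (1 * u) * Real.exp (-(c * u ^ 2)) := by rw [one_mul]
      _ ≤ _ := key 1 (by norm_num)
  · calc u ^ 2 * Real.exp (-(c * u ^ 2)) ≤ Real.exp (2 * u) * Real.exp (-(c * u ^ 2)) :=
          mul_le_mul_of_nonneg_right hu2 hE
      _ ≤ _ := key 2 le_rfl

/-- **The Gaussian lies in the exponential Weil class with rate `1`**: for `c > 0` there is `C`
(namely `(1 + 2c)² e^{9/(4c)}`) with `‖g_c‖, ‖g_c'‖, ‖g_c''‖ ≤ C e^{-|t|}`. [folklore] -/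
theorem gaussEC_bounds {c : ℝ} (hc : 0 < c) :
    ∃ C : ℝ, ∀ t : ℝ,
      ‖(Real.exp (-(c * t ^ 2)) : ℂ)‖ ≤ C * Real.exp (-(1 * |t|)) ∧
      ‖deriv (fun t : ℝ => (Real.exp (-(c * t ^ 2)) : ℂ)) t‖ ≤ C * Real.exp (-(1 * |t|)) ∧
      ‖deriv (deriv (fun t : ℝ => (Real.exp (-(c * t ^ 2)) : ℂ))) t‖ ≤
        C * Real.exp (-(1 * |t|)) := by
  refine ⟨(1 + 2 * c) ^ 2 * Real.exp (9 / (4 * c)), fun t => ?_⟩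
  rw [gaussEC_deriv2 c, gaussEC_deriv c]
  simp only [Complex.norm_real, Real.norm_eq_abs, one_mul]
  obtain ⟨hA, hB, hC⟩ := gaussEC_three hc (abs_nonneg t)
  rw [sq_abs] at hA hB hC
  have hE : 0 < Real.exp (-(c * t ^ 2)) := Real.exp_pos _
  have hX : 0 ≤ Real.exp (9 / (4 * c)) * Real.exp (-|t|) := by positivity
  have hc1 : 1 ≤ (1 + 2 * c) ^ 2 := by nlinarith
  have hc2 : 2 * c ≤ (1 + 2 * c) ^ 2 := by nlinarith
  have hc3 : 4 * c ^ 2 + 2 * c ≤ (1 + 2 * c) ^ 2 := by nlinarith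
  refine ⟨?_, ?_, ?_⟩
  · rw [abs_of_pos hE]
    calc Real.exp (-(c * t ^ 2)) ≤ Real.exp (9 / (4 * c)) * Real.exp (-|t|) := hA
      _ = 1 * (Real.exp (9 / (4 * c)) * Real.exp (-|t|)) := (one_mul _).symm
      _ ≤ (1 + 2 * c) ^ 2 * (Real.exp (9 / (4 * c)) * Real.exp (-|t|)) :=
          mul_le_mul_of_nonneg_right hc1 hX
      _ = _ := by ring
  · have e1 : |-2 * c * t * Real.exp (-(c * t ^ 2))| =
        2 * c * (|t| * Real.exp (-(c * t ^ 2))) := by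
      rw [abs_mul, abs_mul, abs_mul, abs_neg, abs_two, abs_of_pos hc, abs_of_pos hE]
      ring
    rw [e1]
    calc 2 * c * (|t| * Real.exp (-(c * t ^ 2)))
        ≤ 2 * c * (Real.exp (9 / (4 * c)) * Real.exp (-|t|)) :=
          mul_le_mul_of_nonneg_left hB (by positivity)
      _ ≤ (1 + 2 * c) ^ 2 * (Real.exp (9 / (4 * c)) * Real.exp (-|t|)) :=
          mul_le_mul_of_nonneg_right hc2 hX
      _ = _ := by ring
  · have h8 : 0 ≤ 4 * c ^ 2 * t ^ 2 := by positivity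
    have hab : |4 * c ^ 2 * t ^ 2 - 2 * c| ≤ 4 * c ^ 2 * t ^ 2 + 2 * c :=
      abs_le.2 ⟨by linarith, by linarith⟩
    calc |(4 * c ^ 2 * t ^ 2 - 2 * c) * Real.exp (-(c * t ^ 2))|
        = |4 * c ^ 2 * t ^ 2 - 2 * c| * Real.exp (-(c * t ^ 2)) := by
          rw [abs_mul, abs_of_pos hE]
      _ ≤ (4 * c ^ 2 * t ^ 2 + 2 * c) * Real.exp (-(c * t ^ 2)) :=
          mul_le_mul_of_nonneg_right hab hE.le
      _ = 4 * c ^ 2 * (t ^ 2 * Real.exp (-(c * t ^ 2))) + 2 * c * Real.exp (-(c * t ^ 2)) := by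
          ring
      _ ≤ 4 * c ^ 2 * (Real.exp (9 / (4 * c)) * Real.exp (-|t|)) +
            2 * c * (Real.exp (9 / (4 * c)) * Real.exp (-|t|)) :=
          add_le_add (mul_le_mul_of_nonneg_left hC (by positivity))
            (mul_le_mul_of_nonneg_left hA (by positivity))
      _ = (4 * c ^ 2 + 2 * c) * (Real.exp (9 / (4 * c)) * Real.exp (-|t|)) := by ring
      _ ≤ (1 + 2 * c) ^ 2 * (Real.exp (9 / (4 * c)) * Real.exp (-|t|)) :=
          mul_le_mul_of_nonneg_right hc3 hX
      _ = _ := by ring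

/-! ## The stub -/

/-- **Stub E1 — `gaussian_expClass` (RH-free; takes (EF) as hypothesis).**  Every Gaussian
`t ↦ e^{-c t²}`, `c > 0`, lies in the exponential Weil class (rate `1`), so the class explicit
formula applies to it: `Σ'_ρ m(ρ) ĝ_c(ρ) = W(g_c)`, also as the symmetric limit
(`hasWeilZeroSide_tsum`). [folklore] -/
theorem stub_gaussian_expClass :
    (∀ (f : ℝ → ℂ) (C b₀ : ℝ), ContDiff ℝ (⊤ : ℕ∞) f → 1 / 2 < b₀ →
      (∀ t, ‖f t‖ ≤ C * Real.exp (-(b₀ * |t|))) →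
      (∀ t, ‖deriv f t‖ ≤ C * Real.exp (-(b₀ * |t|))) →
      (∀ t, ‖deriv (deriv f) t‖ ≤ C * Real.exp (-(b₀ * |t|))) →
      Summable (fun ρ : ZetaZeros.riemannZetaNontrivialZeros =>
          ‖(riemannZetaZeroOrder (ρ : ℂ) : ℂ) * weilMellin f ρ‖) ∧
      ∑' ρ : ZetaZeros.riemannZetaNontrivialZeros,
          (riemannZetaZeroOrder (ρ : ℂ) : ℂ) * weilMellin f ρ = weilFunctional f) →
    ∀ c : ℝ, 0 < c →
      ContDiff ℝ (⊤ : ℕ∞) (fun t : ℝ => (Real.exp (-(c * t ^ 2)) : ℂ)) ∧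
      (∃ C : ℝ, ∀ t : ℝ,
        ‖(Real.exp (-(c * t ^ 2)) : ℂ)‖ ≤ C * Real.exp (-(1 * |t|)) ∧
        ‖deriv (fun t : ℝ => (Real.exp (-(c * t ^ 2)) : ℂ)) t‖ ≤ C * Real.exp (-(1 * |t|)) ∧
        ‖deriv (deriv (fun t : ℝ => (Real.exp (-(c * t ^ 2)) : ℂ))) t‖ ≤ C * Real.exp (-(1 * |t|))) ∧
      Summable (fun ρ : ZetaZeros.riemannZetaNontrivialZeros =>
          ‖(riemannZetaZeroOrder (ρ : ℂ) : ℂ) * weilMellin (fun t : ℝ => (Real.exp (-(c * t ^ 2)) : ℂ)) ρ‖) ∧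
      HasWeilZeroSide (fun t : ℝ => (Real.exp (-(c * t ^ 2)) : ℂ))
        (weilFunctional (fun t : ℝ => (Real.exp (-(c * t ^ 2)) : ℂ))) ∧
      ∑' ρ : ZetaZeros.riemannZetaNontrivialZeros,
          (riemannZetaZeroOrder (ρ : ℂ) : ℂ) * weilMellin (fun t : ℝ => (Real.exp (-(c * t ^ 2)) : ℂ)) ρ =
        weilFunctional (fun t : ℝ => (Real.exp (-(c * t ^ 2)) : ℂ)) := by
  intro hEF c hc
  obtain ⟨C, hCb⟩ := gaussEC_bounds hc
  have hcd := gaussEC_contDiff c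
  obtain ⟨hS, hT⟩ := hEF (fun t : ℝ => (Real.exp (-(c * t ^ 2)) : ℂ)) C 1 hcd (by norm_num)
    (fun t => (hCb t).1) (fun t => (hCb t).2.1) (fun t => (hCb t).2.2)
  refine ⟨hcd, ⟨C, hCb⟩, hS, ?_, hT⟩
  rw [← hT]
  exact hasWeilZeroSide_tsum hS

end Summit.RiemannHypothesis.RiemannHypothesis.Theorems.GroundStatesConvergeToXi

end
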